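import Literature.NumberTheory.Connes2026.AnnulusCorrectionExpansion
import Mathlib.Analysis.Normed.Ring.InfiniteSum
import HarnessLib

/-!
# Connes 1999 Thm VII.4, `k = ℚ`, `S = {∞} ∪ P` — CLOSED FORM OF THE ANNULUS CORRECTION:
# `u_p^* P_Λ u_p − P_Λ = (1 − p⁻¹) θ_p⁻¹ Q₀ η_p − Q₀` and its absolutely convergent expansion
# `(1 − p⁻¹) Σ_{a,b ≥ 0} p^{−(a+b)/2} ϑ(p^a) Q₀ ϑ(p^{−b}) − Q₀`

LABEL (line 1): RH-FREE literature (theorems only; NO definition, NO named fact).  bears_on: LADDER-RH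
W-C/W-P (C1 named-fact debt), cell `rh-crit`, sub-cell cc, overflow row O1 — green layer under the row's last
named fact `Connes1999_thm_VII_4_rat` (the cases `P ≠ ∅`), eighth file of the "annulus road"
(`SemilocalCutoffConjugation` … `AnnulusGeometricResummation`).  WHAT THIS IS NOT: any claim about positivity,
Weil's criterion or RH — operator algebra of the cutoff correction; nothing here bears on the truth of RH.

Sources.  A. Connes, Selecta Math. 5 (1999) [`Connes1999`], §VII proof of Thm 4, eqs. (29)–(33) (held text
`paper:arxiv-math_9811068`, p0013); A. Connes, C. Consani, H. Moscovici, Ann. Funct. Anal. 15 (2024)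
[`ConnesConsaniMoscovici2024`], §4.2 (44)–(46) (`η_p = Σ_k D_p^k = (1 − D_p)⁻¹`), Thm. 4.6 §4.7 (`θ_p` invertible).

## What is proved

With `u_p = twistUnitary {p}`, `P_Λ = cutoffProj Λ`, `Q₀ = annulusProj p Λ = P_Λ − P_{Λ/p}`, `θ_p⁻¹ = ↑(twistProdUnit {p})⁻¹`,
`η_p = semilocalEta p`, `D_p = primeDilation p`, `ϑ_τ = scalingUnitary τ`:

* `primeDilation_mul_semilocalEta` (`D_p η_p = η_p − 1`), `twistProdUnit_inv_mul_one_sub_primeTwist`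
  (`θ_p⁻¹ (1 − θ_p) = θ_p⁻¹ − 1`), `adjoint_twistUnitary_mul_one_sub_primeTwist`
  (`u_p^* (1 − θ_p) = θ_p⁻¹ − 1 − p⁻¹ θ_p⁻¹`);
* **`cutoffCorrection_singleton_eq`** — the CLOSED FORM
  `u_p^* P_Λ u_p − P_Λ = (1 − p⁻¹) • (θ_p⁻¹ Q₀ η_p) − Q₀` (from the annulus identity of `SemilocalCutoffConjugation`);
* `summable_norm_one_sub_primeTwist_pow_mul`, `summable_norm_primeDilation_pow`,
  **`hasSum_twistInv_annulus_eta`** — `θ_p⁻¹ Q₀ η_p = Σ_{(a,b) ∈ ℕ²} (1 − θ_p)^a Q₀ D_p^b` (Cauchy product of the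
  two Neumann series, absolutely convergent in operator norm);
* `one_sub_primeTwist_pow_mul_mul_primeDilation_pow` — `(1 − θ_p)^a Q₀ D_p^b = p^{−(a+b)/2} • (ϑ_{a log p} Q₀ ϑ_{−b log p})`;
* **`hasSum_cutoffCorrection_singleton`** —
  `u_p^* P_Λ u_p − P_Λ + Q₀ = Σ_{(a,b) ∈ ℕ²} ((1 − p⁻¹) p^{−(a+b)/2}) • (ϑ_{a log p} Q₀ ϑ_{−b log p})`:
  the annulus correction is an absolutely convergent combination of unitary conjugates-and-shifts of the single
  annulus projection `Q₀`, with the geometric weights that `AnnulusGeometricResummation` resums into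
  `connesLocalTerm p g` once `Tr(ϑ(g) ϑ_{a log p} Q₀ ϑ_{−b log p})|_ev = log p · g((a − b) log p)` is available.

No instance, notation or attribute; no `def`.
-/

noncomputable section

open _root_.MeasureTheory Complex Set Filter
open scoped Real Topology ComplexConjugate ENNReal InnerProductSpace

namespace Literature.NumberTheory.Connes2026

open Literature.NumberTheory.LFunctions Literature.Analysis.OperatorTheory
open Literature.NumberTheory.ConnesConsani2024
open Literature.NumberTheory.ConnesConsani2021

variable (p : ℕ) [hp : Fact p.Prime]

/-! ## §1. The closed form -/

section ClosedForm

/-- `D_p η_p = η_p − 1` (`(1 − D_p) η_p = 1`). [cite: ConnesConsaniMoscovici2024, §4.2 eqs. (44)–(46) p. 17 (arXiv chunk p0013:L7)] -/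
theorem primeDilation_mul_semilocalEta : primeDilation p * semilocalEta p = semilocalEta p - 1 := by
  have h := one_sub_primeDilation_mul_semilocalEta p
  rw [sub_mul, one_mul, sub_eq_iff_eq_add] at h
  rw [eq_sub_iff_add_eq, add_comm, ← h]

/-- `θ_p⁻¹ (1 − θ_p) = θ_p⁻¹ − 1`. [cite: ConnesConsaniMoscovici2024, Thm. 4.6 §4.7 p. 22] -/
theorem twistProdUnit_inv_mul_one_sub_primeTwist :
    (↑(twistProdUnit {p})⁻¹ : Lp ℂ 2 (volume : Measure ℝ) →L[ℂ] Lp ℂ 2 (volume : Measure ℝ)) *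
        ((1 : Lp ℂ 2 (volume : Measure ℝ) →L[ℂ] Lp ℂ 2 (volume : Measure ℝ)) - primeTwist p) =
      (↑(twistProdUnit {p})⁻¹ : Lp ℂ 2 (volume : Measure ℝ) →L[ℂ] Lp ℂ 2 (volume : Measure ℝ)) - 1 := by
  rw [mul_sub, mul_one, ← twistProd_singleton, ← val_twistProdUnit, Units.inv_mul]

/-- **`u_p^* (1 − θ_p) = θ_p⁻¹ − 1 − p⁻¹ θ_p⁻¹`** (`u_p^* = θ_p⁻¹ (1 − D_p)` and `D_p (1 − θ_p) = p⁻¹`). [cite: Connes1999, §VII proof of Thm 4 eqs. (30)–(32) (arXiv p0013); ConnesConsaniMoscovici2024, §4.2 (44), Thm. 4.6 §4.7] -/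
theorem adjoint_twistUnitary_mul_one_sub_primeTwist :
    ContinuousLinearMap.adjoint (twistUnitary {p}) *
        ((1 : Lp ℂ 2 (volume : Measure ℝ) →L[ℂ] Lp ℂ 2 (volume : Measure ℝ)) - primeTwist p) =
      (↑(twistProdUnit {p})⁻¹ : Lp ℂ 2 (volume : Measure ℝ) →L[ℂ] Lp ℂ 2 (volume : Measure ℝ)) - 1 -
        ((p : ℂ)⁻¹) • (↑(twistProdUnit {p})⁻¹ : Lp ℂ 2 (volume : Measure ℝ) →L[ℂ] Lp ℂ 2 (volume : Measure ℝ)) := by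
  have hηinv : etaInvProd {p} = 1 - primeDilation p := by
    have : etaInvProd {p} = etaInvAt p := by simp [etaInvProd]
    rw [this, etaInvAt_of_prime]
  rw [adjoint_twistUnitary, hηinv, mul_assoc, sub_mul, one_mul, primeDilation_mul_one_sub_primeTwist, mul_sub,
    twistProdUnit_inv_mul_one_sub_primeTwist, mul_smul_comm, mul_one]

/-- **Closed form of the annulus correction**: `u_p^* P_Λ u_p − P_Λ = (1 − p⁻¹) • (θ_p⁻¹ Q₀ η_p) − Q₀`,
`Q₀ = P_Λ − P_{Λ/p}` (insert `u_p^*(1 − θ_p) = (1 − p⁻¹)θ_p⁻¹ − 1` and `D_p η_p = η_p − 1` into the annulus identity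
`u_p^* P_Λ u_p = P_Λ + u_p^*(1 − θ_p) Q₀ η_p + Q₀ D_p η_p`). [cite: Connes1999, §VII proof of Thm 4 eqs. (29)–(33) (arXiv p0013)] -/
theorem cutoffCorrection_singleton_eq (Λ : ℝ) :
    ContinuousLinearMap.adjoint (twistUnitary {p}) * cutoffProj Λ * twistUnitary {p} - cutoffProj Λ =
      (1 - (p : ℂ)⁻¹) • ((↑(twistProdUnit {p})⁻¹ : Lp ℂ 2 (volume : Measure ℝ) →L[ℂ] Lp ℂ 2 (volume : Measure ℝ)) *
        annulusProj p Λ * semilocalEta p) - annulusProj p Λ := by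
  rw [adjoint_twistUnitary_mul_cutoffProj_mul_twistUnitary, adjoint_twistUnitary_mul_one_sub_primeTwist,
    mul_assoc (annulusProj p Λ) (primeDilation p), primeDilation_mul_semilocalEta]
  set θi := (↑(twistProdUnit {p})⁻¹ : Lp ℂ 2 (volume : Measure ℝ) →L[ℂ] Lp ℂ 2 (volume : Measure ℝ))
  set Q := annulusProj p Λ
  set η := semilocalEta p
  rw [sub_mul, sub_mul, sub_mul, sub_mul, one_mul, smul_mul_assoc, smul_mul_assoc, mul_sub, mul_one, sub_smul,
    one_smul]
  abel

end ClosedForm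

/-! ## §2. The absolutely convergent double expansion -/

section Expansion

omit hp in
/-- `‖A^n‖ ≤ ‖A‖^n` for bounded operators (`‖1‖ ≤ 1`). [folklore] -/
private theorem opNorm_pow_le (A : Lp ℂ 2 (volume : Measure ℝ) →L[ℂ] Lp ℂ 2 (volume : Measure ℝ)) (n : ℕ) :
    ‖A ^ n‖ ≤ ‖A‖ ^ n := by
  induction n with
  | zero => rw [pow_zero, pow_zero]; exact ContinuousLinearMap.norm_id_le
  | succ n ih =>
    rw [pow_succ, pow_succ]
    exact (ContinuousLinearMap.opNorm_comp_le _ _).trans (mul_le_mul_of_nonneg_right ih (norm_nonneg _))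

/-- `Σ_a ‖(1 − θ_p)^a B‖ < ∞` (`‖1 − θ_p‖ = p^{−1/2} < 1`). [cite: ConnesConsaniMoscovici2024, Thm. 4.6 §4.7 p. 22] -/
theorem summable_norm_one_sub_primeTwist_pow_mul (B : Lp ℂ 2 (volume : Measure ℝ) →L[ℂ] Lp ℂ 2 (volume : Measure ℝ)) :
    Summable fun a : ℕ =>
      ‖((1 : Lp ℂ 2 (volume : Measure ℝ) →L[ℂ] Lp ℂ 2 (volume : Measure ℝ)) - primeTwist p) ^ a * B‖ := by
  refine Summable.of_nonneg_of_le (fun _ => norm_nonneg _) (fun a => ?_)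
    ((summable_geometric_of_lt_one (norm_nonneg _) (norm_one_sub_primeTwist_lt_one p)).mul_right ‖B‖)
  exact (ContinuousLinearMap.opNorm_comp_le _ _).trans
    (mul_le_mul_of_nonneg_right (opNorm_pow_le _ a) (norm_nonneg _))

/-- `Σ_b ‖D_p^b‖ < ∞` (`‖D_p‖ = p^{−1/2} < 1`). [cite: ConnesConsaniMoscovici2024, §4.2 eq. (44) p. 16] -/
theorem summable_norm_primeDilation_pow : Summable fun b : ℕ => ‖primeDilation p ^ b‖ :=
  Summable.of_nonneg_of_le (fun _ => norm_nonneg _) (fun b => opNorm_pow_le _ b)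
    (summable_geometric_of_lt_one (norm_nonneg _) (norm_primeDilation_lt_one p))

/-- **`θ_p⁻¹ B η_p = Σ_{(a,b) ∈ ℕ²} (1 − θ_p)^a B D_p^b`** for any bounded `B` (Cauchy product of `θ_p⁻¹ = Σ (1−θ_p)^a`
and `η_p = Σ D_p^b`, absolutely convergent). [cite: Connes1999, §VII proof of Thm 4 eqs. (30)–(33) (arXiv p0013); ConnesConsaniMoscovici2024, §4.2 (44)–(46), Thm. 4.6] -/
theorem hasSum_twistInv_mul_mul_eta (B : Lp ℂ 2 (volume : Measure ℝ) →L[ℂ] Lp ℂ 2 (volume : Measure ℝ)) :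
    HasSum (fun ab : ℕ × ℕ =>
        ((1 : Lp ℂ 2 (volume : Measure ℝ) →L[ℂ] Lp ℂ 2 (volume : Measure ℝ)) - primeTwist p) ^ ab.1 * B *
          primeDilation p ^ ab.2)
      ((↑(twistProdUnit {p})⁻¹ : Lp ℂ 2 (volume : Measure ℝ) →L[ℂ] Lp ℂ 2 (volume : Measure ℝ)) * B *
        semilocalEta p) := by
  -- (Mathlib's `summable_mul_of_summable_norm` is avoided: its `NormedRing`-norm on `L(H)` elaborates slowly.)
  set T : Lp ℂ 2 (volume : Measure ℝ) →L[ℂ] Lp ℂ 2 (volume : Measure ℝ) := 1 - primeTwist p with hT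
  have hf : HasSum (fun a : ℕ => T ^ a * B)
      ((↑(twistProdUnit {p})⁻¹ : Lp ℂ 2 (volume : Measure ℝ) →L[ℂ] Lp ℂ 2 (volume : Measure ℝ)) * B) :=
    (hasSum_twistProdUnit_singleton_inv p).mul_right B
  have hg := hasSum_semilocalEta p
  have hfn : Summable fun a : ℕ => ‖T ^ a * B‖ := summable_norm_one_sub_primeTwist_pow_mul p B
  have hgn : Summable fun b : ℕ => ‖primeDilation p ^ b‖ := summable_norm_primeDilation_pow p
  have hFn : Summable fun ab : ℕ × ℕ => ‖T ^ ab.1 * B‖ * ‖primeDilation p ^ ab.2‖ :=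
    hfn.mul_of_nonneg hgn (fun _ => norm_nonneg _) (fun _ => norm_nonneg _)
  have hF : Summable fun ab : ℕ × ℕ => T ^ ab.1 * B * primeDilation p ^ ab.2 :=
    Summable.of_norm_bounded hFn fun ab => ContinuousLinearMap.opNorm_comp_le _ _
  have hS := hF.hasSum
  have hrows : ∀ a : ℕ, HasSum (fun b : ℕ => T ^ a * B * primeDilation p ^ b) (T ^ a * B * semilocalEta p) :=
    fun a => hg.mul_left (T ^ a * B)
  have h1 := hS.prod_fiberwise hrows
  have h2 : HasSum (fun a : ℕ => T ^ a * B * semilocalEta p)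
      ((↑(twistProdUnit {p})⁻¹ : Lp ℂ 2 (volume : Measure ℝ) →L[ℂ] Lp ℂ 2 (volume : Measure ℝ)) * B *
        semilocalEta p) := hf.mul_right (semilocalEta p)
  rwa [h1.unique h2] at hS

/-- `(1 − θ_p)^a B D_p^b = p^{−(a+b)/2} • (ϑ_{a log p} B ϑ_{−b log p})`. [cite: ConnesConsaniMoscovici2024, §4.2 eq. (44), §4.6 p. 22] -/
theorem one_sub_primeTwist_pow_mul_mul_primeDilation_pow
    (B : Lp ℂ 2 (volume : Measure ℝ) →L[ℂ] Lp ℂ 2 (volume : Measure ℝ)) (a b : ℕ) :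
    ((1 : Lp ℂ 2 (volume : Measure ℝ) →L[ℂ] Lp ℂ 2 (volume : Measure ℝ)) - primeTwist p) ^ a * B *
        primeDilation p ^ b =
      ((((Real.sqrt p)⁻¹ : ℝ) : ℂ) ^ (a + b)) •
        (scalingUnitary (a * Real.log p) * B * scalingUnitary (b * (-Real.log p))) := by
  rw [one_sub_primeTwist_pow, primeDilation_pow_eq_smul, smul_mul_assoc, smul_mul_assoc, mul_smul_comm,
    smul_smul, ← pow_add, add_comm]

/-- **The annulus correction as an absolutely convergent double series**:
`u_p^* P_Λ u_p − P_Λ + Q₀ = Σ_{(a,b) ∈ ℕ²} ((1 − p⁻¹) p^{−(a+b)/2}) • (ϑ_{a log p} Q₀ ϑ_{−b log p})`, `Q₀ = P_Λ − P_{Λ/p}`. [cite: Connes1999, §VII proof of Thm 4 eqs. (29)–(33) (arXiv p0013)] -/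
theorem hasSum_cutoffCorrection_singleton (Λ : ℝ) :
    HasSum (fun ab : ℕ × ℕ =>
        ((1 - (p : ℂ)⁻¹) * (((Real.sqrt p)⁻¹ : ℝ) : ℂ) ^ (ab.1 + ab.2)) •
          (scalingUnitary (ab.1 * Real.log p) * annulusProj p Λ * scalingUnitary (ab.2 * (-Real.log p))))
      (ContinuousLinearMap.adjoint (twistUnitary {p}) * cutoffProj Λ * twistUnitary {p} - cutoffProj Λ +
        annulusProj p Λ) := by
  rw [cutoffCorrection_singleton_eq, sub_add_cancel]
  have h := (hasSum_twistInv_mul_mul_eta p (annulusProj p Λ)).const_smul (1 - (p : ℂ)⁻¹)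
  refine h.congr_fun fun ab => ?_
  rw [one_sub_primeTwist_pow_mul_mul_primeDilation_pow, smul_smul]

omit hp in
/-- `‖(P_b − P_a) x‖ ≤ ‖x‖`: pointwise `|1_{[-b,b]} − 1_{[-a,a]}| ≤ 1`. [cite: Connes1999, §VII eq. (12) (arXiv p0013)] -/
theorem norm_cutoffProj_sub_cutoffProj_apply_le (a b : ℝ) (x : Lp ℂ 2 (volume : Measure ℝ)) :
    ‖(cutoffProj b - cutoffProj a) x‖ ≤ ‖x‖ := by
  refine Lp.norm_le_norm_of_ae_le ?_
  rw [sub_apply]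
  filter_upwards [Lp.coeFn_sub (cutoffProj b x) (cutoffProj a x), cutoffProj_coeFn b x, cutoffProj_coeFn a x]
    with v h1 h2 h3
  rw [h1, Pi.sub_apply, h2, h3]
  by_cases hb : v ∈ Icc (-b) b <;> by_cases ha : v ∈ Icc (-a) a <;>
    simp [Set.indicator_of_mem, Set.indicator_of_notMem, hb, ha]

omit hp in
/-- `‖Q₀ x‖ ≤ ‖x‖` for the annulus `Q₀ = P_Λ − P_{Λ/p}`. [cite: Connes1999, §VII eq. (12) (arXiv p0013)] -/
theorem norm_annulusProj_le (Λ : ℝ) : ‖annulusProj p Λ‖ ≤ 1 := by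
  rw [annulusProj_def]
  refine ContinuousLinearMap.opNorm_le_bound _ zero_le_one fun x => ?_
  rw [one_mul]
  exact norm_cutoffProj_sub_cutoffProj_apply_le _ _ x

omit hp in
/-- Norm control of the summands: `‖ϑ_{a log p} Q₀ ϑ_{−b log p}‖ ≤ 1` (unitaries and a difference of cutoffs). [cite: Connes1999, §VII eq. (12) (arXiv p0013); ConnesConsani2021, §4 eq. (40)] -/
theorem norm_scalingUnitary_mul_annulusProj_mul_le (Λ : ℝ) (a b : ℕ) :
    ‖scalingUnitary (a * Real.log p) * annulusProj p Λ * scalingUnitary (b * (-Real.log p))‖ ≤ 1 := by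
  have hϑ : ∀ τ : ℝ, ‖scalingUnitary τ‖ ≤ 1 := fun τ =>
    ContinuousLinearMap.opNorm_le_bound _ zero_le_one fun x => by rw [one_mul, norm_scalingUnitary_apply]
  have hQ : ‖annulusProj p Λ‖ ≤ 1 := norm_annulusProj_le p Λ
  calc ‖scalingUnitary (a * Real.log p) * annulusProj p Λ * scalingUnitary (b * (-Real.log p))‖
      ≤ ‖scalingUnitary (a * Real.log p) * annulusProj p Λ‖ * ‖scalingUnitary (b * (-Real.log p))‖ :=
        ContinuousLinearMap.opNorm_comp_le _ _
    _ ≤ (‖scalingUnitary (a * Real.log p)‖ * ‖annulusProj p Λ‖) * 1 :=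
        mul_le_mul (ContinuousLinearMap.opNorm_comp_le _ _) (hϑ _) (norm_nonneg _)
          (mul_nonneg (norm_nonneg _) (norm_nonneg _))
    _ ≤ 1 * 1 * 1 := by
        gcongr
        · exact hϑ _
    _ = 1 := by norm_num

end Expansion

end Literature.NumberTheory.Connes2026
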